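/-
Origin: expansion seat `planner-pub-hodgecm-toy2-g2-0`, handover #3 2026-08-18T05:04:00Z (`HOME/pub-hodgecm-toy2-g2/lean/Toy2g2/StarHodge.lean`, md5 65a44250, 195 lines);
landed by the gen-6 packager in gate run 22 as `HodgeCM/Model/Toy/StarHodge.lean` (import ^import Toy2g2\.Star(Top|Dual|Obj|Hodge|AlgDuality)\b→import HodgeCM.Model.Toy.Star\1 ×1).
-/
/-
Copyright: pub-hodgecm formalisation cell (harness21, 2026). New file (not vendored).
Origin: HOME/pub-hodgecm-toy2-g2/lean/Toy2g2/StarHodge.lean (WIP module `Toy2g2.StarHodge`; intended final place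
`HodgeCM/Model/Toy/StarHodge.lean` = module `HodgeCM.Model.Toy.StarHodge`, CONTRIBUTING §3 L5) (seat
planner-pub-hodgecm-toy2-g2-0, consistency seat 2 gen 2, towards M28 `Fact_algDuality` in the toy universe).
-/
import Summits.HodgeConjecture.HodgeCM.Model.Toy.StarObj

/-!
# The star operator of the twisted trace form respects the Hodge filtration

Let `X` be a toy object with conjugation data `C`, `dim_ℚ L X = k + l`, and let `⋆ : ⋀^k_ℚ L X → ⋀^l_ℚ L X` be the
star operator (`Toy2g2.StarDual`) of the twisted trace form `b = C.form` (`Toy2g2.StarObj`).  We transport `⋆ ⊗ ℂ` to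
`⋀_ℂ (ℂ ⊗ L X)` along `Θ` (`starC`) and show:

* `coe_mul_starC`: the wedge characterisation survives complexification, `x ∧ ⋆_ℂ y = β_ℂ(x, y) vol_ℂ` with `β_ℂ` the
  Gram-determinant form of `b ⊗ ℂ`;
* `β_formC_basis_eq_zero`: in the eigen-wedge-basis `e_S`, `β_ℂ(e_{S₁}, e_{S₂}) = 0` unless `S₂ = S̄₁`;
* `starC_basis`: hence `⋆_ℂ e_S` is a multiple of `e_{(S̄)ᶜ}`;
* `thetaLin_starQ_mem_FF`: counting holomorphic indices, `⋆` maps `F^p ⋀^k` into `F^q ⋀^l` whenever `2q + k ≤ 2p + l`.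
-/

noncomputable section

open scoped TensorProduct

namespace HodgeCM.Toy

namespace Obj

open exteriorPower Module Set Set.powersetCard

/-- the image of the canonical enumeration of a `k`-set is the set -/
lemma image_ofFinEmbEquiv_symm {α : Type*} [LinearOrder α] {n : ℕ} (T : powersetCard α n) :
    Finset.univ.image (ofFinEmbEquiv.symm T) = T.val := by
  ext s
  simp only [Finset.mem_image, Finset.mem_univ, true_and]
  rw [← Set.mem_range, mem_range_ofFinEmbEquiv_symm_iff_mem, ← mem_coe_iff]

variable {X : Obj} (C : X.ConjData) {k l : ℕ} (hV : Module.finrank ℚ X.L = k + l)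

/-- `θ_k : ⋀^k_ℚ L X → ⋀^k_ℂ (ℂ ⊗ L X)`, `x ↦ Θ (1 ⊗ x)` -/
abbrev θ (X : Obj) (k : ℕ) : ⋀[ℚ]^k X.L →ₗ[ℚ] ⋀[ℂ]^k X.LC := BC.thetaLin ℚ ℂ X.L k

/-- (Ported verbatim from the HodgeCMPerL package; no docstring in the source.) -/
lemma theta_one_tmul (x : ⋀[ℚ]^k X.L) : X.Θ k (1 ⊗ₜ x) = X.θ k x := by
  rw [BC.thetaEquiv_apply, BC.theta_tmul, one_smul]

/-- the complex volume element `θ vol` -/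
def volC : ⋀[ℂ]^(k + l) X.LC := X.θ (k + l) (Star.vol hV)

namespace ConjData

/-- the `ℚ`-star operator of the twisted trace form, `⋆ : ⋀^k L X → ⋀^l L X` -/
abbrev starQ : ⋀[ℚ]^k X.L →ₗ[ℚ] ⋀[ℚ]^l X.L := Star.star hV C.form

/-- `⋆ ⊗ ℂ`, transported to `⋀_ℂ (ℂ ⊗ L X)` along `Θ` -/
def starC : ⋀[ℂ]^k X.LC →ₗ[ℂ] ⋀[ℂ]^l X.LC :=
  (X.Θ l).toLinearMap ∘ₗ (C.starQ hV).baseChange ℂ ∘ₗ (X.Θ k).symm.toLinearMap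

/-- (Ported verbatim from the HodgeCMPerL package; no docstring in the source.) -/
lemma starC_theta (y : ⋀[ℚ]^k X.L) : C.starC hV (X.Θ k (1 ⊗ₜ y)) = X.Θ l (1 ⊗ₜ C.starQ hV y) := by
  show X.Θ l ((C.starQ hV).baseChange ℂ ((X.Θ k).symm (X.Θ k (1 ⊗ₜ y)))) = _
  rw [LinearEquiv.symm_apply_apply, LinearMap.baseChange_tmul]

/-- (Ported verbatim from the HodgeCMPerL package; no docstring in the source.) -/
lemma starC_thetaLin (y : ⋀[ℚ]^k X.L) : C.starC hV (X.θ k y) = X.θ l (C.starQ hV y) := by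
  rw [← theta_one_tmul, starC_theta, theta_one_tmul]

/-- **Base change of the Gram-determinant form**: `β_ℂ(θ x, θ y) = β(x, y)`. -/
theorem β_formC_thetaLin (x y : ⋀[ℚ]^k X.L) :
    Star.β C.formC (X.θ k x) (X.θ k y) = algebraMap ℚ ℂ (Star.β C.form x y) := by
  have key : ((Star.β C.formC).restrictScalars₁₂ ℚ ℚ).compl₁₂ (X.θ k) (X.θ k)
      = (Star.β C.form).compr₂ (Algebra.linearMap ℚ ℂ) := by
    apply linearMap_ext
    refine AlternatingMap.ext fun u => ?_
    apply linearMap_ext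
    refine AlternatingMap.ext fun w => ?_
    simp only [LinearMap.compAlternatingMap_apply, LinearMap.compl₁₂_apply, LinearMap.restrictScalars₁₂_apply_apply,
      LinearMap.compr₂_apply, Algebra.linearMap_apply, BC.thetaLin_ιMulti, Star.β_ιMulti, formC_tmul, mul_one,
      RingHom.map_det]
    congr 1
    ext i j
    simp [Matrix.map_apply, Algebra.smul_def]
  simpa using LinearMap.congr_fun₂ key x y

/-- the wedge characterisation on the image of `θ` -/
lemma coe_thetaLin_mul_starC (x y : ⋀[ℚ]^k X.L) :
    (X.θ k x : ExteriorAlgebra ℂ X.LC) * (X.θ l (C.starQ hV y) : ExteriorAlgebra ℂ X.LC)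
      = Star.β C.formC (X.θ k x) (X.θ k y) • (volC hV : ExteriorAlgebra ℂ X.LC) := by
  rw [← BC.thetaLin_wedge, Star.wedge_star, map_smul, Submodule.coe_smul_of_tower, β_formC_thetaLin,
    algebraMap_smul, volC]

/-- the bilinear map `(x, y) ↦ x ∧ ⋆_ℂ y` (values in the exterior algebra) -/
def mulStar : ⋀[ℂ]^k X.LC →ₗ[ℂ] ⋀[ℂ]^k X.LC →ₗ[ℂ] ExteriorAlgebra ℂ X.LC :=
  (LinearMap.mul ℂ (ExteriorAlgebra ℂ X.LC)).compl₁₂ (⋀[ℂ]^k X.LC).subtype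
    ((⋀[ℂ]^l X.LC).subtype ∘ₗ C.starC hV)

/-- (Ported verbatim from the HodgeCMPerL package; no docstring in the source.) -/
lemma mulStar_apply (x y : ⋀[ℂ]^k X.LC) :
    C.mulStar hV x y = (x : ExteriorAlgebra ℂ X.LC) * (C.starC hV y : ExteriorAlgebra ℂ X.LC) := rfl

/-- the bilinear map `(x, y) ↦ β_ℂ(x, y) vol_ℂ` -/
def betaVol : ⋀[ℂ]^k X.LC →ₗ[ℂ] ⋀[ℂ]^k X.LC →ₗ[ℂ] ExteriorAlgebra ℂ X.LC :=
  (Star.β C.formC).compr₂ (LinearMap.toSpanSingleton ℂ _ (volC hV : ExteriorAlgebra ℂ X.LC))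

/-- (Ported verbatim from the HodgeCMPerL package; no docstring in the source.) -/
lemma betaVol_apply (x y : ⋀[ℂ]^k X.LC) :
    C.betaVol hV x y = Star.β C.formC x y • (volC hV : ExteriorAlgebra ℂ X.LC) := rfl

/-- a `ℂ`-basis of `⋀^k_ℂ (ℂ ⊗ L X)` coming from `⋀^k_ℚ L X` -/
def basisC : Basis (powersetCard (Fin (k + l)) k) ℂ (⋀[ℂ]^k X.LC) :=
  (Algebra.TensorProduct.basis ℂ ((Star.bV hV).exteriorPower k)).map (X.Θ k)

/-- (Ported verbatim from the HodgeCMPerL package; no docstring in the source.) -/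
lemma basisC_apply (S : powersetCard (Fin (k + l)) k) : basisC hV S = X.θ k ((Star.bV hV).exteriorPower k S) := by
  rw [basisC, Basis.map_apply, Algebra.TensorProduct.basis_apply, theta_one_tmul]

/-- (Ported verbatim from the HodgeCMPerL package; no docstring in the source.) -/
lemma mulStar_eq_betaVol : C.mulStar hV = C.betaVol hV := by
  refine LinearMap.ext_basis (basisC hV) (basisC hV) fun S T => ?_
  rw [basisC_apply, basisC_apply, mulStar_apply, betaVol_apply, starC_thetaLin]
  exact C.coe_thetaLin_mul_starC hV _ _

/-- **Wedge characterisation over `ℂ`**: `x ∧ ⋆_ℂ y = β_ℂ(x, y) · vol_ℂ`. -/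
theorem coe_mul_starC (x y : ⋀[ℂ]^k X.LC) :
    (x : ExteriorAlgebra ℂ X.LC) * (C.starC hV y : ExteriorAlgebra ℂ X.LC)
      = Star.β C.formC x y • (volC hV : ExteriorAlgebra ℂ X.LC) := by
  rw [← mulStar_apply, ← betaVol_apply, mulStar_eq_betaVol]

/-- **Orthogonality in the eigen-wedge-basis**: `β_ℂ(e_{S₁}, e_{S₂}) = 0` unless `S₂ = S̄₁`. -/
theorem β_formC_basis_eq_zero (S₁ S₂ : powersetCard X.Idx k) (h : S₂ ≠ X.barC S₁) :
    Star.β C.formC (X.eB.exteriorPower k S₁) (X.eB.exteriorPower k S₂) = 0 := by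
  rw [basis_apply, basis_apply, ιMulti_family, ιMulti_family, Star.β_ιMulti]
  obtain ⟨j, hj⟩ : ∃ j : Fin k, X.bar (ofFinEmbEquiv.symm S₁ j) ∉ S₂ := by
    by_contra hall
    apply h
    symm
    rw [eq_iff_subset]
    intro s hs
    have hs' : X.bar s ∈ Set.range (ofFinEmbEquiv.symm S₁) := by
      rw [mem_range_ofFinEmbEquiv_symm_iff_mem]
      exact (X.mem_barC S₁ s).mp (mem_coe_iff.mp hs)
    obtain ⟨j, hj⟩ := hs'
    have : X.bar (ofFinEmbEquiv.symm S₁ j) = s := by rw [hj, bar_bar]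
    exact mem_coe_iff.mpr (this ▸ not_not.mp fun hn => hall ⟨j, hn⟩)
  refine Matrix.det_eq_zero_of_column_eq_zero j fun i => C.formC_eB_eq_zero fun heq => hj ?_
  rw [← heq]
  exact (mem_range_ofFinEmbEquiv_symm_iff_mem S₂ _).mp ⟨i, rfl⟩

/-- complement of complement -/
lemma compl_compl_eq {m n : ℕ} (hmn : m + n = Fintype.card X.Idx) (hnm : n + m = Fintype.card X.Idx)
    (T : powersetCard X.Idx n) : compl hnm (compl hmn T) = T := by
  apply Subtype.ext
  rw [coe_compl, coe_compl, compl_compl]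

/-- **`⋆_ℂ e_S` is a multiple of `e_{(S̄)ᶜ}`.** -/
theorem starC_basis (hlk : l + k = Fintype.card X.Idx) (S : powersetCard X.Idx k) :
    C.starC hV (X.eB.exteriorPower k S)
      = (X.eB.exteriorPower l).repr (C.starC hV (X.eB.exteriorPower k S)) (compl hlk (X.barC S))
          • X.eB.exteriorPower l (compl hlk (X.barC S)) := by
  set Z := C.starC hV (X.eB.exteriorPower k S) with hZ
  have hkl : k + l = Fintype.card X.Idx := (add_comm k l).trans hlk
  have hT : ∀ T : powersetCard X.Idx l, T ≠ compl hlk (X.barC S) → (X.eB.exteriorPower l).repr Z T = 0 := by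
    intro T hT
    have h3 : Star.β C.formC (X.eB.exteriorPower k (compl hkl T)) (X.eB.exteriorPower k S) = 0 := by
      refine C.β_formC_basis_eq_zero _ _ fun hS => hT ?_
      rw [hS, barC_barC, compl_compl_eq]
    have hz : (↑(X.eB.exteriorPower k (compl hkl T)) : ExteriorAlgebra ℂ X.LC) * ↑Z = 0 := by
      rw [hZ, coe_mul_starC, h3, zero_smul]
    rw [Star.basis_compl_mul_eq X.eB hkl T Z, smul_eq_zero_iff_eq, smul_eq_zero] at hz
    rcases hz with hz | hz
    · exact hz
    · exact absurd ((Submodule.coe_eq_zero).mp hz) (Basis.ne_zero _ _)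
  conv_lhs => rw [← (X.eB.exteriorPower l).sum_repr Z]
  rw [Finset.sum_eq_single (compl hlk (X.barC S)) (fun T _ hT' => by rw [hT T hT', zero_smul]) (by simp)]

/-- **The star operator respects the Hodge filtrations**: `⋆ (F^p ⋀^k) ⊆ F^q ⋀^l` whenever `2q + k ≤ 2p + l`. -/
theorem thetaLin_starQ_mem_FF (hlk : l + k = Fintype.card X.Idx) {p q : ℤ} (hpq : 2 * q + k ≤ 2 * p + l)
    {y : ⋀[ℚ]^k X.L} (hy : X.θ k y ∈ X.FF k p) : X.θ l (C.starQ hV y) ∈ X.FF l q := by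
  rw [← starC_thetaLin]
  suffices hsub : Submodule.span ℂ ((X.eB.exteriorPower k) '' {S | p ≤ (X.nhol S.val : ℤ)})
      ≤ (X.FF l q).comap (C.starC hV) from hsub (X.FF_le_span k p hy)
  rw [Submodule.span_le]
  rintro _ ⟨S, hS, rfl⟩
  show C.starC hV (X.eB.exteriorPower k S) ∈ X.FF l q
  rw [C.starC_basis hV hlk S]
  refine Submodule.smul_mem _ _ ?_
  rw [basis_apply, ιMulti_family, ← mono_def]
  apply mono_mem_FF
  rw [← X.nhol_image _ (ofFinEmbEquiv.symm (compl hlk (X.barC S))).injective, image_ofFinEmbEquiv_symm]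
  have h1 := X.two_mul_nhol_compl_barC hlk S
  have h2 : p ≤ (X.nhol S.val : ℤ) := hS
  omega

end ConjData

end Obj

end HodgeCM.Toy

end
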